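import Summits.Ventures.PercRepro.RankLevelSetCircuitCount
import Summits.Ventures.PercRepro.RankLevelSetTriangleStar

/-!
# PercRepro — THE TRIANGLE COUNT AT BOUNDED NULLITY: `2·s₃ ≤ ν(ν + 1)` under (C1) (p2, gen 14; SUBCLAIM-S1 Lemma T)

`proofs/SUBCLAIM-S1-p2.md` §4, LEMMA T. In a finite matroid in which every rank-`2` set has at most `3` elements
((C1)), the number of `3`-element circuits is at most `ν(ν + 1)/2`, where `ν = |E| − r(E)` is the nullity. This
replaces `RankLevelSetTriangleStar.ncard_triangles_le_sq` (`s₃ ≤ ν²`) in the counts of the `q = 4` window.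

PROOF (deletion induction on `|E|`, the pattern of `RankLevelSetCircuitCount.ncard_circuits_le_choose`). If there is
no triangle there is nothing to prove; otherwise pick `e` on one. `e` is not a coloop, so `M ＼ {e}` has nullity
`ν − 1` (`dual_eRank_delete_singleton_add_one`), satisfies (C1) (`delete_singleton_eRk_eq`), and its triangles are
the triangles of `M` avoiding `e` (`delete_isCircuit_iff`); the triangles through `e` number at most `ν`
(`ThmN.ncard_trianglesThrough_le`: under (C1) they pairwise meet only in `e`). Hence
`2·s₃(M) ≤ 2·ν + (ν − 1)·ν = ν(ν + 1)`.

* **`two_mul_ncard_triangles_le`** — `2·#(triangles M) ≤ d·(d + 1)` when `|E| = r(E) + d` and (C1) holds.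
Axioms: standard.
-/

open scoped Matroid

namespace PercRepro

namespace S1

open Set

variable {α : Type}

/-- **LEMMA T — the triangle count at bounded nullity.** If `|E| = r(E) + d` and every rank-`2` set has at most
`3` elements, then `M` has at most `d(d + 1)/2` triangles: `2·#(triangles M) ≤ d·(d + 1)`. Deletion induction on
`|E|`: the triangles through a point `e` of some triangle number at most `d`, the others are the triangles of
`M ＼ {e}`, a matroid of nullity `d − 1` satisfying (C1). -/
theorem two_mul_ncard_triangles_le (M : Matroid α) [M.Finite]
    (hC1 : ∀ L ⊆ M.E, M.eRk L = 2 → L.ncard ≤ 3) {d : ℕ} (hd : M.E.encard = M.eRank + d) :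
    2 * (ThmN.triangles M).ncard ≤ d * (d + 1) := by
  suffices H : ∀ n : ℕ, ∀ (M : Matroid α) [M.Finite], M.E.ncard = n →
      (∀ L ⊆ M.E, M.eRk L = 2 → L.ncard ≤ 3) → ∀ d : ℕ, M.E.encard = M.eRank + d →
      2 * (ThmN.triangles M).ncard ≤ d * (d + 1) from H _ M rfl hC1 d hd
  intro n
  induction n using Nat.strong_induction_on with
  | _ n ih =>
  intro M _ hn hC1 d hd
  classical
  set S := ThmN.triangles M with hS
  have hSfin : S.Finite :=
    M.ground_finite.finite_subsets.subset (fun C hC => hC.1.subset_ground)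
  by_cases hSe : S = ∅
  · rw [hSe, ncard_empty]; exact Nat.zero_le _
  obtain ⟨C₀, hC₀⟩ := nonempty_iff_ne_empty.2 hSe
  obtain ⟨e, heC₀⟩ := hC₀.1.nonempty
  have heE : e ∈ M.E := hC₀.1.subset_ground heC₀
  -- `e` lies on a circuit, so it is not a coloop: `M ＼ {e}` has nullity `d − 1`
  have hne : ¬ M.IsColoop e := hC₀.1.not_isColoop_of_mem heC₀
  have hν : M✶.eRank = (d : ℕ∞) := by
    have h := _root_.Matroid.eRank_add_eRank_dual M
    rw [hd] at h
    exact WithTop.add_left_cancel (PercRepro.Matroid.eRank_ne_top_of_finite M) h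
  have hdel := PercRepro.Matroid.dual_eRank_delete_singleton_add_one heE hne
  rw [hν] at hdel
  have hfin' : (M ＼ {e})✶.eRank ≠ ⊤ := by
    intro h
    rw [h] at hdel
    exact absurd hdel (by simp)
  obtain ⟨d', hd'⟩ := ENat.ne_top_iff_exists.1 hfin'
  have hdd' : d = d' + 1 := by
    rw [← hd'] at hdel
    exact_mod_cast hdel.symm
  -- the `encard` form of the nullity of `M ＼ {e}`
  have hd'enc : (M ＼ {e}).E.encard = (M ＼ {e}).eRank + d' := by
    have h := _root_.Matroid.eRank_add_eRank_dual (M ＼ {e})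
    rw [← hd'] at h
    exact h.symm
  have hdelE : (M ＼ {e}).E.ncard < n := by
    rw [_root_.Matroid.delete_ground, ← hn, ← ncard_sdiff_singleton_add_one heE M.ground_finite]
    omega
  -- (C1) passes to `M ＼ {e}`
  have hC1' : ∀ L ⊆ (M ＼ {e}).E, (M ＼ {e}).eRk L = 2 → L.ncard ≤ 3 := by
    intro L hL hr
    rw [_root_.Matroid.delete_ground] at hL
    rw [delete_singleton_eRk_eq hL] at hr
    exact hC1 L (hL.trans sdiff_subset) hr
  -- split the triangles by whether they contain `e`
  set S₁ := ThmN.trianglesThrough M e with hS₁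
  set S₂ := {C | M.IsCircuit C ∧ C.ncard = 3 ∧ e ∉ C} with hS₂
  have hsplit : S ⊆ S₁ ∪ S₂ := by
    intro C hC
    by_cases h : e ∈ C
    · exact Or.inl ⟨hC.1, hC.2, h⟩
    · exact Or.inr ⟨hC.1, hC.2, h⟩
  have hS₁fin : S₁.Finite := hSfin.subset (fun C hC => ⟨hC.1, hC.2.1⟩)
  have hS₂fin : S₂.Finite := hSfin.subset (fun C hC => ⟨hC.1, hC.2.1⟩)
  -- `e` is not a loop (it lies on a `3`-element circuit)
  have hx : M.IsNonloop e := by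
    refine _root_.Matroid.isNonloop_of_not_isLoop heE ?_
    intro hloop
    have hC₀e : C₀ = {e} := hloop.eq_of_isCircuit_mem hC₀.1 heC₀
    have := hC₀.2
    rw [hC₀e, ncard_singleton] at this
    omega
  -- the triangles through `e`: at most `d`
  have h1 : S₁.ncard ≤ d := ThmN.ncard_trianglesThrough_le M hC1 hx hd
  -- the triangles avoiding `e` are the triangles of `M ＼ {e}`
  have h2 : 2 * S₂.ncard ≤ d' * (d' + 1) := by
    have hsub : S₂ ⊆ ThmN.triangles (M ＼ {e}) := by
      intro C hC
      exact ⟨_root_.Matroid.delete_isCircuit_iff.2 ⟨hC.1, disjoint_singleton_right.2 hC.2.2⟩, hC.2.1⟩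
    calc 2 * S₂.ncard ≤ 2 * (ThmN.triangles (M ＼ {e})).ncard := by
          apply Nat.mul_le_mul_left
          exact ncard_le_ncard hsub
            ((M ＼ {e}).ground_finite.finite_subsets.subset (fun C hC => hC.1.subset_ground))
      _ ≤ d' * (d' + 1) := ih _ hdelE (M ＼ {e}) rfl hC1' d' hd'enc
  have h3 : 2 * S.ncard ≤ 2 * S₁.ncard + 2 * S₂.ncard := by
    calc 2 * S.ncard ≤ 2 * (S₁ ∪ S₂).ncard := by
          apply Nat.mul_le_mul_left
          exact ncard_le_ncard hsplit (hS₁fin.union hS₂fin)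
      _ ≤ 2 * (S₁.ncard + S₂.ncard) := by
          apply Nat.mul_le_mul_left
          exact ncard_union_le _ _
      _ = 2 * S₁.ncard + 2 * S₂.ncard := by ring
  subst hdd'
  nlinarith [h1, h2, h3]

end S1

end PercRepro
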